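import Mathlib
import HarnessLib
import Summits.Ventures.LatticeQCDFlow.Exactness.SpreadingKernelDoeblin

/-!
# Schedules: a locally spreading update interleaved with ANY SEQUENCE of exact steps keeps a Doeblin bound; periodic schedules converge from every start

HONEST FRAMING: exact (Metropolis-corrected) sampling algorithms for lattice gauge theory;
figures of merit are autocorrelation/cost numbers at stated couplings and volumes; no
continuum-physics claim.

Venture `LatticeQCDFlow` (cell pub-lqcd), topic `Exactness`, FANOUT row 9 (eng-latcore, the engine's composite
sweeps when the exact step CHANGES from sweep to sweep: a different over-relaxation schedule, subgroup order or
frame each time, or a periodic programme `update, OR₁, update, OR₂, …`).  NEW WORK of the cell over the tree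
(`SpreadingKernelDoeblin.lean`: `spreading_round` with a closing step different from the previous one,
`exists_le_measure_ball`, `exists_coverNumber` via `SpreadingKernelLemmas.lean`; `InvariantComposition.lean`:
`cycle`, `nHit`, `invariant_cycle`; `MetropolisSweepConvergence.lean`: `uniformlyErgodic_of_nHit_minorised`;
`DoeblinUniqueness.lean`).  Nothing is cited as a fact; no number is claimed.

The iteration of `SpreadingKernelDoeblin.lean` never used that the exact step is the same each round: the
set-growth bookkeeping only needs the step closing the PREVIOUS round to leave `π` invariant.  Hence:

* §1 `cycle_cons_comp_apply`, **`exists_cycle_rounds`** (after the rounds `(K, P_1), …, (K, P_ℓ)` from `x` the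
  law dominates `c (cθ)^{ℓ-1} · (π|_A) P_ℓ` with `π A ≥ v + (ℓ-1) v/2` or `A = univ`),
  **`exists_cycle_minorised`** — `K` Markov, `π`-invariant and locally spreading: there are `m` and `a ≠ 0`
  such that for EVERY list of `π`-invariant Markov kernels `P_1, …, P_ℓ` with `ℓ ≥ m + 1` and every `x`,
  `a • π ≤ (P_ℓ ∘ₖ K) ∘ₖ ⋯ ∘ₖ (P_1 ∘ₖ K)` at `x` — ONE `m`, ONE `a` for all schedules.
* §2 `nHit_cycle_eq_cycle_replicate`, **`cycle_schedule_uniformlyErgodic`** — for `π` a probability law and any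
  nonempty period `Ps` of `π`-invariant Markov kernels, the periodic chain `Q = cycle (Ps.map (· ∘ₖ K))` satisfies
  `|μ₀ Qᵗ(A) − π(A)| ≤ (1 − ε)^{⌊t/(m+1)⌋}` for some `m`, `ε ∈ (0, 1]`, EVERY initial law, every `t`, every `A`,
  and `π` is its unique invariant probability law.

NOT CLAIMED: random (rather than prescribed) schedules as a single kernel on a larger space (the bound above is
uniform over schedules, which is what an annealed argument needs, but the packaging is not written); any value of
`m`, `ε`; floating point.
-/

noncomputable section

namespace Summit.Ventures.LatticeQCDFlow.Exactness

open MeasureTheory Measure Metric Set Filter Topology Function ProbabilityTheory ProbabilityTheory.Kernel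
open scoped ENNReal

variable {X : Type*} [PseudoMetricSpace X] [MeasurableSpace X] [BorelSpace X] [SecondCountableTopology X]

/-! ## §1 Rounds along a schedule -/

section Schedule

variable [CompactSpace X] [PreconnectedSpace X] {π : Measure X} [IsFiniteMeasure π] {K : Kernel X X}
  {c : ℝ≥0∞} {r : ℝ}

omit [PseudoMetricSpace X] [BorelSpace X] [SecondCountableTopology X] [CompactSpace X] [PreconnectedSpace X]
  [IsFiniteMeasure π] in
/-- Evaluating a schedule: `cycle [P ∘ₖ K, schedule…] x = ((cycle schedule x) K) P`. -/
theorem cycle_cons_comp_apply (P : Kernel X X) (Ps : List (Kernel X X)) (x : X) :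
    cycle (((P :: Ps).map fun Q => Q ∘ₖ K)) x = ((cycle (Ps.map fun Q => Q ∘ₖ K) x).bind K).bind P := by
  rw [List.map_cons, cycle_cons, Kernel.comp_apply, bind_kernel_comp]

/-- **THE ROUNDS ALONG A SCHEDULE.**  With the constants of `SpreadingKernelDoeblin.lean` (`v`: lower bound for
`r/4`-balls, `θ`: the thickness level), for EVERY schedule `P :: Ps` (head applied LAST) of `π`-invariant Markov
kernels and every `x` there is a set `A` with `v + |Ps|·(v/2) ≤ π A` or `A = univ` and
`(c (cθ)^{|Ps|}) • (π|_A) P ≤ cycle ((P :: Ps).map (· ∘ₖ K)) x`. -/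
theorem exists_cycle_rounds (hr : 0 < r) (hK : ∀ y, c • π.restrict (ball y r) ≤ K y)
    {v : ℝ≥0∞} (hv0 : v ≠ 0) (hvtop : v ≠ ⊤) (hv : ∀ x, v ≤ π (ball x (r / 4)))
    {N : ℕ} (hN : ∀ (σ : Measure X) (θ : ℝ≥0∞), σ {w | σ (ball w (r / 2)) < θ} ≤ N * θ)
    {θ : ℝ≥0∞} (hθv : θ ≤ v) (hNθ : (N : ℝ≥0∞) * θ ≤ v / 2) :
    ∀ (Ps : List (Kernel X X)) (P : Kernel X X), (∀ Q ∈ P :: Ps, IsMarkovKernel Q ∧ Invariant Q π) →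
      ∀ x, ∃ A : Set X, (v + Ps.length * (v / 2) ≤ π A ∨ A = univ) ∧
        (c * (c * θ) ^ Ps.length) • (π.restrict A).bind P ≤ cycle ((P :: Ps).map fun Q => Q ∘ₖ K) x := by
  intro Ps
  induction Ps with
  | nil =>
      intro P _ x
      refine ⟨ball x r, Or.inl ?_, ?_⟩
      · rw [List.length_nil, Nat.cast_zero, zero_mul, add_zero]
        exact (hv x).trans (measure_mono (ball_subset_ball (by linarith)))
      · rw [List.length_nil, pow_zero, mul_one, List.map_cons, List.map_nil, cycle_cons, cycle_nil, Kernel.comp_id,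
          Kernel.comp_apply]
        calc c • (π.restrict (ball x r)).bind P = (c • π.restrict (ball x r)).bind P := (Measure.bind_smul _ _ _).symm
          _ ≤ (K x).bind P := bind_mono_left (hK x) P
  | cons Q Ps ih =>
      intro P hPs x
      have hQ : IsMarkovKernel Q ∧ Invariant Q π := hPs Q (List.mem_cons_of_mem P List.mem_cons_self)
      haveI := hQ.1
      obtain ⟨A, hlo, hmin⟩ := ih Q (fun Q' hQ' => hPs Q' (List.mem_cons_of_mem P hQ')) x
      obtain ⟨A', -, hlo', hmin'⟩ := spreading_round hQ.2 P hr hK hv0 hvtop hv hN hθv hNθ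
        (b := v + Ps.length * (v / 2)) le_self_add hlo hmin
      refine ⟨A', ?_, ?_⟩
      · rcases hlo' with h | h
        · left
          rw [List.length_cons, Nat.cast_succ, add_mul, one_mul, ← add_assoc]
          exact h
        · exact Or.inr h
      · rw [cycle_cons_comp_apply, List.length_cons, pow_succ, ← mul_assoc]
        exact hmin'

/-- **ANY SCHEDULE OF EXACT STEPS: ONE DOEBLIN BOUND FOR ALL OF THEM.**  `K` Markov, leaving `π` invariant and
spreading locally (`K(y, ·) ≥ c · π|_{B(y, r)}`, `c ≠ 0`, `r > 0`; `π` finite, charging every ball, `X` compact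
preconnected): there are `m` and `a ≠ 0` such that for EVERY list `Ps` of `π`-invariant Markov kernels with
`m + 1 ≤ |Ps|` and every `x`, `a • π ≤ cycle (Ps.map (· ∘ₖ K)) x` — the rounds "update, then the next exact
step of the schedule". -/
theorem exists_cycle_minorised [IsMarkovKernel K] (hKinv : Invariant K π) (hr : 0 < r) (hc : c ≠ 0)
    (hK : ∀ y, c • π.restrict (ball y r) ≤ K y) (hpos : ∀ (x : X) (ρ : ℝ), 0 < ρ → π (ball x ρ) ≠ 0) :
    ∃ m : ℕ, ∃ a : ℝ≥0∞, a ≠ 0 ∧ ∀ (Ps : List (Kernel X X)), (∀ Q ∈ Ps, IsMarkovKernel Q ∧ Invariant Q π) →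
      m + 1 ≤ Ps.length → ∀ x, a • π ≤ cycle (Ps.map fun Q => Q ∘ₖ K) x := by
  rcases isEmpty_or_nonempty X with hX | ⟨⟨x₀⟩⟩
  · exact ⟨0, 1, one_ne_zero, fun Ps _ _ x => (IsEmpty.false x).elim⟩
  -- the constants (as in `exists_nHit_comp_minorised`)
  obtain ⟨v, hv0, hv⟩ := exists_le_measure_ball π hpos (show 0 < r / 4 by positivity)
  have hvtop : v ≠ ⊤ := ne_top_of_le_ne_top (measure_ne_top π _) (hv x₀)
  obtain ⟨N, hN⟩ := exists_coverNumber (X := X) (show 0 < r / 2 by positivity)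
  set θ : ℝ≥0∞ := v / 2 / ((N : ℝ≥0∞) + 1) with hθ
  have hN1 : ((N : ℝ≥0∞) + 1) ≠ 0 := by simp
  have hN1top : ((N : ℝ≥0∞) + 1) ≠ ⊤ := by simp
  have hv2 : v / 2 ≠ 0 := (ENNReal.div_pos_iff.2 ⟨hv0, ENNReal.ofNat_ne_top⟩).ne'
  have hθ0 : θ ≠ 0 := (ENNReal.div_pos_iff.2 ⟨hv2, hN1top⟩).ne'
  have hθv : θ ≤ v := by
    rw [hθ]
    refine (ENNReal.div_le_of_le_mul ?_).trans ENNReal.half_le_self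
    exact le_mul_of_one_le_right zero_le (by simp)
  have hNθ : (N : ℝ≥0∞) * θ ≤ v / 2 := by
    rw [hθ]
    calc (N : ℝ≥0∞) * (v / 2 / ((N : ℝ≥0∞) + 1)) ≤ ((N : ℝ≥0∞) + 1) * (v / 2 / ((N : ℝ≥0∞) + 1)) :=
          mul_le_mul' (by simp) le_rfl
      _ = v / 2 := ENNReal.mul_div_cancel hN1 hN1top
  -- the length after which the set must be everything
  obtain ⟨n, hn⟩ := ENNReal.exists_nat_mul_gt (a := v / 2) (b := π univ) hv2 (measure_ne_top π univ)
  refine ⟨n, c * (c * θ) ^ n, mul_ne_zero hc (pow_ne_zero _ (mul_ne_zero hc hθ0)), fun Ps hPs hlen x => ?_⟩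
  -- split the schedule: the first `n + 1` rounds applied (the suffix `Rs`), then the rest (the prefix `Qs`)
  set j : ℕ := Ps.length - (n + 1) with hj
  have hsplit : Ps = Ps.take j ++ Ps.drop j := (List.take_append_drop j Ps).symm
  have hRlen : (Ps.drop j).length = n + 1 := by rw [List.length_drop, hj]; omega
  obtain ⟨R, Rs, hR⟩ : ∃ R Rs, Ps.drop j = R :: Rs :=
    List.exists_cons_of_length_pos (by rw [hRlen]; exact Nat.succ_pos n)
  have hRslen : Rs.length = n := by
    have h := hRlen; rw [hR, List.length_cons] at h; omega
  have hmemR : ∀ Q ∈ R :: Rs, IsMarkovKernel Q ∧ Invariant Q π := fun Q hQ =>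
    hPs Q (by rw [hsplit, hR]; exact List.mem_append_right _ hQ)
  have hmemQ : ∀ Q ∈ Ps.take j, IsMarkovKernel Q ∧ Invariant Q π := fun Q hQ => hPs Q (List.mem_of_mem_take hQ)
  -- the suffix: after `n + 1` rounds the set is everything
  obtain ⟨A, hlo, hmin⟩ := exists_cycle_rounds hr hK hv0 hvtop hv hN hθv hNθ Rs R hmemR x
  have hAu : A = univ := by
    rcases hlo with h | h
    · exfalso
      rw [hRslen] at h
      have h' : π univ < π A := hn.trans_le (le_add_self.trans h)
      exact absurd (measure_mono (subset_univ A)) (not_le.2 h')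
    · exact h
  haveI := (hmemR R List.mem_cons_self).1
  rw [hAu, Measure.restrict_univ, (hmemR R List.mem_cons_self).2.def, hRslen] at hmin
  -- the prefix keeps the bound (every member is exact, so is the cycle)
  have hinvQ : Invariant (cycle ((Ps.take j).map fun Q => Q ∘ₖ K)) π := by
    refine invariant_cycle fun κ hκ => ?_
    obtain ⟨Q, hQ, rfl⟩ := List.mem_map.1 hκ
    exact (hmemQ Q hQ).2.comp hKinv
  rw [hsplit, List.map_append, cycle_append, Kernel.comp_apply, hR]
  calc (c * (c * θ) ^ n) • π = ((c * (c * θ) ^ n) • π).bind (cycle ((Ps.take j).map fun Q => Q ∘ₖ K)) := by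
        rw [Measure.bind_smul, hinvQ.def]
    _ ≤ (cycle ((R :: Rs).map fun Q => Q ∘ₖ K) x).bind (cycle ((Ps.take j).map fun Q => Q ∘ₖ K)) :=
        bind_mono_left hmin _

end Schedule

/-! ## §2 Periodic schedules converge from every start -/

section Periodic

variable [CompactSpace X] [PreconnectedSpace X] {π : Measure X} [IsProbabilityMeasure π] {K : Kernel X X}
  [IsMarkovKernel K] {c : ℝ≥0∞} {r : ℝ}

omit [PseudoMetricSpace X] [BorelSpace X] [SecondCountableTopology X] [CompactSpace X] [PreconnectedSpace X]
  [IsProbabilityMeasure π] [IsMarkovKernel K] in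
/-- Powers of a period are the cycle of the repeated period: `(cycle L)^j = cycle (L ++ ⋯ ++ L)` (`j` copies). -/
theorem nHit_cycle_eq_cycle_replicate (L : List (Kernel X X)) :
    ∀ j : ℕ, nHit (cycle L) j = cycle (List.replicate j L).flatten
  | 0 => by rw [nHit_zero, List.replicate_zero, List.flatten_nil, cycle_nil]
  | j + 1 => by
      rw [nHit_succ, nHit_cycle_eq_cycle_replicate L j, List.replicate_succ, List.flatten_cons, cycle_append]

/-- **A PERIODIC PROGRAMME "UPDATE, EXACT STEP₁, UPDATE, EXACT STEP₂, …" CONVERGES FROM EVERY START, AT EVERY TIME,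
AND HAS `π` AS ITS ONLY INVARIANT LAW.**  `π` a probability law charging every ball on a compact preconnected
space; `K` Markov, `π`-invariant, spreading locally; `Ps` a nonempty list of `π`-invariant Markov kernels (the
exact steps of one period, head applied last).  With `Q = cycle (Ps.map (· ∘ₖ K))` (one period) there are `m` and
`ε ∈ (0, 1]` with `|μ₀ Qᵗ(A) − π(A)| ≤ (1 − ε)^{⌊t/(m+1)⌋}` for EVERY initial law `μ₀`, every `t`, every `A`; and
every `Q`-invariant probability law is `π`. -/
theorem cycle_schedule_uniformlyErgodic (hKinv : Invariant K π) (hr : 0 < r) (hc : c ≠ 0)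
    (hK : ∀ y, c • π.restrict (ball y r) ≤ K y) (hpos : ∀ (x : X) (ρ : ℝ), 0 < ρ → π (ball x ρ) ≠ 0)
    {Ps : List (Kernel X X)} (hPs : ∀ Q ∈ Ps, IsMarkovKernel Q ∧ Invariant Q π) (hne : Ps ≠ []) :
    ∃ m : ℕ, ∃ ε : ℝ, 0 < ε ∧ ε ≤ 1 ∧
      (∀ (μ₀ : Measure X) [IsProbabilityMeasure μ₀] (t : ℕ) (A : Set X),
        |((fun ν : Measure X => ν.bind (cycle (Ps.map fun Q => Q ∘ₖ K)))^[t] μ₀).real A - π.real A| ≤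
          (1 - ε) ^ (t / (m + 1))) ∧
      ∀ (π' : Measure X) [IsProbabilityMeasure π'], Invariant (cycle (Ps.map fun Q => Q ∘ₖ K)) π' → π' = π := by
  obtain ⟨m, a, ha0, hmin⟩ := exists_cycle_minorised hKinv hr hc hK hpos
  obtain ⟨x₀⟩ := nonempty_of_isProbabilityMeasure π
  -- the period is an exact Markov kernel
  haveI : IsMarkovKernel (cycle (Ps.map fun Q => Q ∘ₖ K)) := by
    refine isMarkovKernel_cycle fun κ hκ => ?_
    obtain ⟨Q, hQ, rfl⟩ := List.mem_map.1 hκ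
    haveI := (hPs Q hQ).1
    infer_instance
  have hinv : Invariant (cycle (Ps.map fun Q => Q ∘ₖ K)) π := by
    refine invariant_cycle fun κ hκ => ?_
    obtain ⟨Q, hQ, rfl⟩ := List.mem_map.1 hκ
    exact (hPs Q hQ).2.comp hKinv
  -- `m + 1` periods contain at least `m + 1` rounds
  have hlen : m + 1 ≤ ((List.replicate (m + 1) Ps).flatten).length := by
    rw [List.length_flatten, List.map_replicate, List.sum_replicate, smul_eq_mul]
    exact Nat.le_mul_of_pos_right _ (List.length_pos_of_ne_nil hne)
  have hmem : ∀ Q ∈ (List.replicate (m + 1) Ps).flatten, IsMarkovKernel Q ∧ Invariant Q π := fun Q hQ => by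
    obtain ⟨L, hL, hQL⟩ := List.mem_flatten.1 hQ
    rw [List.eq_of_mem_replicate hL] at hQL
    exact hPs Q hQL
  have hpow : ∀ x, a • π ≤ nHit (cycle (Ps.map fun Q => Q ∘ₖ K)) (m + 1) x := fun x => by
    have h := hmin ((List.replicate (m + 1) Ps).flatten) hmem hlen x
    rwa [List.map_flatten, List.map_replicate, ← nHit_cycle_eq_cycle_replicate] at h
  haveI : IsMarkovKernel (nHit (cycle (Ps.map fun Q => Q ∘ₖ K)) (m + 1)) := isMarkovKernel_nHit _ _
  have ha1 : a ≤ 1 := by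
    have h := Measure.le_iff'.1 (hpow x₀) univ
    rwa [Measure.smul_apply, smul_eq_mul, measure_univ, measure_univ, mul_one] at h
  have hatop : a ≠ ⊤ := ne_top_of_le_ne_top ENNReal.one_ne_top ha1
  refine ⟨m, a.toReal, ENNReal.toReal_pos ha0 hatop, ENNReal.toReal_le_of_le_ofReal zero_le_one
    (by rwa [ENNReal.ofReal_one]), fun μ₀ _ t A => uniformlyErgodic_of_nHit_minorised hpow hinv μ₀ t A,
    fun π' _ hπ' => ?_⟩
  exact invariant_unique_of_minorised (κ := nHit (cycle (Ps.map fun Q => Q ∘ₖ K)) (m + 1)) hpow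
    (pos_iff_ne_zero.2 ha0) (invariant_nHit hinv _) (invariant_nHit hπ' _)

end Periodic

end Summit.Ventures.LatticeQCDFlow.Exactness
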